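import Literature.NumberTheory.LFunctions.WeilArchDensityPanelTM
import HarnessLib

/-!
# Panel Taylor models of the archimedean density `ρ(t) = e^{t/2}/(2 sinh t)` away from `t = 0`

Literature layer T1 (NumberTheory/LFunctions); namespace `Literature.NumberTheory.LFunctions`.  Sequel of
`WeilArchDensityPanelTM.lean` (panel models `gPanelI` of the regularised density `g(t) = t ρ(t)`).  On a panel
`t = t₀ + u`, `|u| ≤ h₂`, with `h₂ < t₀` (so `t > 0` on the panel), `ρ(t₀ + u) = g(t₀ + u) · (t₀ + u)⁻¹`; the model is the
truncated product of `gPanelI … t₀ 1 …` with the verified reciprocal (`checkInv`) of the affine model `t₀ + u` by a thin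
candidate `Qt` widened by `et`:

* `rhoPanelI`, `rhoPanelCheck`, `tmem_rhoPanel` — if the check accepts, `rhoPanelI …` encloses `u ↦ ρ(t₀ + u)` on `|u| ≤ h₂`.

These are the `Dρ` inputs of the moving-integral models of the tail `Ψ(L) = ∫_L^∞ ρ` (`WeilArchTailPanels.lean`).
Problem-independent validated numerics of Bombieri's archimedean density [Bombieri2000Weil, Thm 2]; no facts, no axioms.

## References

* E. Bombieri, *Remarks on Weil's quadratic functional in the theory of prime numbers, I*, Rend. Mat. Acc. Lincei (9) 11
  (2000) 183–233, Thm 2. [cite: Bombieri2000Weil]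
* K. Makino, M. Berz, *Taylor models and other validated functional inclusion methods*, Int. J. Pure Appl. Math. 4 (2003)
  379–456. [folklore]
-/

noncomputable section

open Real Set MeasureTheory

namespace Literature.NumberTheory.LFunctions

open Literature.Analysis.ValidatedNumerics.PolyMP Literature.Analysis.ValidatedNumerics.NumericsMP
open Literature.Analysis.ValidatedNumerics.ExpPoly (Poly)

/-- **Panel model of `ρ(t₀ + u)`**, `|u| ≤ h₂`: `gPanelI` (unit slope) times the verified reciprocal of `t₀ + u`
(thin candidate `Qt` widened by `et`), truncated at degree `D`. [folklore] -/
def rhoPanelI (S : ℕ) (h₂ : ℚ) (D K Ke ke : ℕ) (t0 : ℚ) (Q : List ℤ) (e : ℕ) (Qt : List ℤ) (et : ℕ) : IPoly :=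
  tmulI S h₂ D (gPanelI S h₂ D K Ke ke t0 1 Q e) (widen0 (thinI Qt) et)

/-- The acceptance test: `gPanelCheck` (unit slope), the reciprocal certificate of `t₀ + u`, and `h₂ < t₀`. [folklore] -/
def rhoPanelCheck (S : ℕ) (h₂ : ℚ) (D Kφ lam Ke ke : ℕ) (t0 : ℚ) (Q : List ℤ) (e : ℕ) (Qt : List ℤ) (et : ℕ) : Bool :=
  gPanelCheck S h₂ D Kφ lam Ke ke t0 1 Q e && checkInv S h₂ D (taffineI S t0 1) (thinI Qt) et && decide (h₂ < t0)

/-- **Soundness of the panel model of `ρ`.**  If `0 ≤ h₂ ≤ 2`, `0 < K`, `0 < Kφ`, `0 < λ` and `rhoPanelCheck` accepts, then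
`rhoPanelI …` encloses `u ↦ ρ(t₀ + u)` on `|u| ≤ h₂`. [folklore] -/
theorem tmem_rhoPanel {S : ℕ} (hS : 0 < S) {h₂ : ℚ} (h0 : 0 ≤ h₂) (hh2 : h₂ ≤ 2) {D K Kφ lam Ke ke : ℕ} (hK : 0 < K)
    (hKφ : 0 < Kφ) (hlam : 0 < lam) {t0 : ℚ} {Q : List ℤ} {e : ℕ} {Qt : List ℤ} {et : ℕ}
    (hchk : rhoPanelCheck S h₂ D Kφ lam Ke ke t0 Q e Qt et = true) :
    TMem S h₂ (fun u ↦ weilArchDensity ((t0 : ℝ) + u)) (rhoPanelI S h₂ D K Ke ke t0 Q e Qt et) := by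
  unfold rhoPanelCheck at hchk
  simp only [Bool.and_eq_true, decide_eq_true_eq] at hchk
  obtain ⟨⟨hg, hic⟩, ht0⟩ := hchk
  have hG := tmem_gPanel hS h0 one_pos (by rw [one_mul]; exact hh2) hK hKφ hlam (c := t0)
    (by rw [one_mul]; exact ht0.le) hg
  have hinv := tmem_inv_of_check hS h0 (D := D) (tmem_affine S h₂ t0 1) (tmem_thin hS h₂ Qt) hic
  have hprod := tmem_mul hS h0 D hG hinv
  intro u hu
  obtain ⟨as, has, hev⟩ := hprod u hu
  refine ⟨as, has, ?_⟩
  rw [← hev]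
  have ht : 0 < (t0 : ℝ) + u := by
    have h1 : -(h₂ : ℝ) ≤ u := (abs_le.1 hu).1
    have h2 : ((h₂ : ℚ) : ℝ) < t0 := by exact_mod_cast ht0
    linarith
  have e1 : weilArchDensity ((t0 : ℝ) + u) = weilArchDensityG ((t0 : ℝ) + u) * ((t0 : ℝ) + u)⁻¹ := by
    rw [weilArchDensityG_of_ne ht.ne', mul_comm ((t0 : ℝ) + u), mul_assoc, mul_inv_cancel₀ ht.ne', mul_one]
  beta_reduce
  rw [e1]
  push_cast
  rw [one_mul]

end Literature.NumberTheory.LFunctions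

end
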